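import Summits.QuantumFields.YangMills.Theorems.BalabanUVNodesN15PerCubeGreenSopInverseClass
import Summits.QuantumFields.YangMills.Theorems.BalabanUVNodesN15PerCubeGreenProjection
import Summits.QuantumFields.YangMills.Theorems.BalabanUVNodesN15PerCubeGreenLandauCov
import Summits.QuantumFields.YangMills.Theorems.BalabanUVNodesN15PerCubeGreenFineObjects
import HarnessLib

/-!
# N15 = NE2, road (c) — PROGRAMME (PC) «[B9] Sect. C FOR THE LANDAU LETTER WITH PER-CUBE GAUGES (3.35) AS PRINTED», (PC-E′) continued: THE LANDAU-TERM FACES OF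
# (PC-B)∕(PC-C) ON BOTH GRIDS OF THE TWO-SPACING PAIRING BY TRANSPORT — `(Q′G′²Q′ᵀ)⁻¹(U)`, `I − R(U)`, `R(U)` and `D_U(I − R(U))D*_U` decay per cube for `U` in the class (3.35)
# at the spacings `L^{−k}` AND `L^{−r}L^{−k}` under ONE constant block (dag-n15-c g31, n15-c∕329)

Cell `pub-ymgap`, seat `pub-ymgap-dag-n15-c` (generation g31; R134 (a) seat, strategy s1 «first missing estimate»; HUMAN RULING D-0062; chair R424 venue).
`bears_on: R4∕N15 · K3⁸ SpineGivenEndpointR13SepCoPHV (stmt-QuantumFields-27366)`; filed `--kind proof --supports stmt-QuantumFields-27366 --as helper` — COUNT-NEUTRAL.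
Four theorems, 0 `def`, 0 `sorry`; TRANSPORT ∕ bookkeeping over landed theorems, NO new estimate.  Imports BY NAME n15-c∕299f `…PerCubeGreenSopInverseClass`
(`hasMaj_cSop_inv_of_reg335Box10`), n15-c∕299g `…PerCubeGreenProjection` (`hasMaj_cPi_of_reg335BigBox`, `hasMaj_cR_of_reg335BigBox`), n15-c∕299h `…PerCubeGreenLandauCov`
(`hasMaj_landauCov_of_reg335BigBox`) and n15-c∕260′ `…PerCubeGreenFineObjects` (`ScX'`, `scShift'`).  Nothing in the tree is modified, no landed name re-declared.

WHY (HOME `PCE-DESIGN-g31.md` §1∕§3; n15-c∕327 `…PerCubeGreenFineTransport` for the method).  Under the resolvent architecture of (PC-E) (n15-c∕328: the η-defect of Bałaban's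
propagator IS `−G′·𝔇(A′,A)·G`), the R-part `N_V^R(U) = D_U(I − R(U))D*_U − flat` of the operator defect is expanded by Leibniz (`T4EtaRateDefect.idef_comp`) and the exact inverse
rule (`idef_inv`) down to defects of LOCAL operators sandwiched between the single-grid factors `G′(U) = (Δ′_a(U))⁻¹` (n15-c∕266 coarse ∕ 266′ fine), `(Q′G′²Q′ᵀ)⁻¹(U)` (n15-c∕299f),
`I − R(U)`, `R(U)` (n15-c∕299g) and the whole Landau term (n15-c∕299h) — each needed on BOTH grids of the pairing with the SAME constants («stability» in «rate = stability ×
consistency»).  THIS FILE supplies 299f∕299g∕299h on both grids by the transport of n15-c∕327: the coarse theorem at index `r + k` IS the fine theorem at `(k, r)` (`cvM` is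
defeq-free of `k`; `unitTorusGeo L k` enters `HasMaj` only through `Site`∕`dist`; `delta` the k-indexed wrappers `ScX`∕`scShift`, `generalize_proofs`, `rw [pow_add]`, `exact`).
The Sop faces live on the COARSE-lattice carrier `Tor (cvM)` (k-free), the Landau faces on the bond carrier with the unit-block map `b ↦ blockOf n (cvM) b.1` (n15-c∕327
`cvBlk_comp_kingPrV` converts to the two-grid files' `cvBlk ∘ kingPrV` spelling).

WHAT THIS FILE PROVES (kernel) — each a conjunction «coarse theorem verbatim ∧ its fine edition», same witnesses `δ, w₀, R₀, B`:
* §1 ★★★ `hasMaj_cSop_inv_of_reg335Box10_twoGrid` (n15-c∕299f: `(Q′G′²Q′ᵀ)⁻¹(U) ≤ B n^{d+1} e^{−δd}` on the coarse-lattice carrier, `n = L^k` resp. `L^rL^k`, mass `a_K(a₀,L,·)·n^{d+1}`).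
* §2 ★★★ `hasMaj_cPi_of_reg335BigBox_twoGrid`, ★★★ `hasMaj_cR_of_reg335BigBox_twoGrid` (n15-c∕299g: `I − R(U)` and `R(U)` on coloured 1-forms).
* §3 ★★★ `hasMaj_landauCov_of_reg335BigBox_twoGrid` (n15-c∕299h: `D_U(I − R(U))D*_U`).

HONEST FRAMING ∕ LIMITS.  Transport only: the fine conjuncts are the landed coarse theorems at index `r + k`, re-typed on the fine carriers; no analytic input; the two grids'
fields are INDEPENDENT (no pairing, no η-defect — (PC-E) proper; its transport∕pairing design is the planner's, HOME `PCE-DESIGN-g31.md`); MODEL carriers (doubled-cube torus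
cover, one averaging level, unit weights, per-cube gauges from r06's `Reg335Cube`); [Balaban1985BackgroundPropagators] Thm 3.3 p.398, (3.25)–(3.26) pp.394–395, (3.35) p.396,
(3.48) p.398, (3.95)–(3.96) p.411 = SHAPES ∕ MECHANISM, nothing printed is asserted; [King1986] p.664 = the pairing convention.  NE2⁺ NOT PRINTED, NOT proved; N15 of record
untouched (DISCHARGED AS CONSUMED, p687738); K3⁸ OPEN; counts of record UNMOVED (typed 28∕28 · discharged 8∕27); one finite 𝕋⁴ at fixed ε per index — NOT infinite volume, NOT
OS on ℝ⁴, NOT a mass gap, NOT Clay; R4 closes the conditional finite-𝕋⁴ rung `BalabanLadder.UV` only.  Restate-immune (no Theses import).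
-/

noncomputable section

open scoped BigOperators Matrix Matrix.Norms.L2Operator

namespace Summit.QuantumFields.YangMills.BalabanUVNodes.N15.Gluing

open Real
open Literature.MathematicalPhysics.QuantumFieldTheory.Balaban1983to89
open Literature.MathematicalPhysics.QuantumFieldTheory.Balaban1983to89.B5Prop11Plancherel (Tor fine unitVec)
open Literature.MathematicalPhysics.QuantumFieldTheory.Balaban1983to89.B11SectG (BlockNorm HasMaj)
open Literature.MathematicalPhysics.QuantumFieldTheory.Balaban1983to89.B6UnitTorusCarrier (unitTorusGeo)
open Literature.MathematicalPhysics.QuantumFieldTheory.Balaban1983to89.B9Eq335RegularityClasses (Reg335Cube)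
open Literature.MathematicalPhysics.QuantumFieldTheory.Balaban1983to89.B9Eq3117Current (gaugeTr)
open Literature.MathematicalPhysics.QuantumFieldTheory.Balaban1983to89.B9Eq39Adjoint (covD fluct)
open Literature.MathematicalPhysics.QuantumFieldTheory.King1986 (aK)
open Literature.MathematicalPhysics.QuantumFieldTheory.King1986.Torus (blockOf)
open Literature.Barriers.QuantumFields (traceForm)
open Summit.QuantumFields.YangMills.BalabanUVNodes.N15.MatrixSpecies (basisConst liftBlk)
open Summit.QuantumFields.YangMills.BalabanUVNodes.N15.TwoGrid (cubeBlocks)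
open Summit.QuantumFields.YangMills.BalabanUVNodes.N15.CovLandau (cSop cGreen csavg cPi cR landauCov)

variable {d : ℕ} {L : ℕ} [NeZero L]

/-! ## §1 `(Q′G′²Q′ᵀ)⁻¹(U)` per cube, on both grids -/

section Sop

/-- ★★★ **n15-c∕299f ON BOTH GRIDS OF THE PAIRING, ONE CONSTANT BLOCK**: `(Q′G′²Q′ᵀ)⁻¹(U)` for `U` in the per-cube class on the Sop boxes decays on the coarse-lattice carrier with
`≤ B·n^{d+1}·e^{−δd}`, `n = L^k` (coarse field `U`) resp. `n = L^rL^k` (fine field `U′`), same `δ, w₀, R₀, B`. [cite: Balaban1985BackgroundPropagators, (3.48) p.398, (3.95)–(3.96) p.411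
(shape ∕ mechanism); King1986, p.664 (pairing)] -/
theorem hasMaj_cSop_inv_of_reg335Box10_twoGrid (hL : Odd L ∧ 1 < L) (hL11 : 11 ≤ L) {a₀ : ℝ} (ha₀ : 0 < a₀) (ι : Type) [Fintype ι] [DecidableEq ι] :
    ∃ δ w₀ R₀ B : ℝ, 0 < δ ∧ 0 < R₀ ∧ 0 < B ∧
      (∀ (mv kk : ℕ), 1 ≤ kk → w₀ ≤ ((L ^ mv : ℕ) : ℝ) →
      ∀ {mm : Type} [Fintype mm] [DecidableEq mm] [Nonempty mm] (e : Matrix mm mm ℂ ≃L[ℝ] (ι → ℝ)), (∀ A B : Matrix mm mm ℂ, traceForm A B = e A ⬝ᵥ e B) →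
      ∀ (U : Fin (d + 1) → ScX d L mv kk hL → (Matrix mm mm ℂ)ˣ), (∀ μ x, (U μ x : Matrix mm mm ℂ) ∈ Matrix.unitaryGroup mm ℂ) →
      ∀ (ξ C : ℝ), 0 < ξ → 0 < C →
        (∀ k : Fin (d + 1) → ZMod (2 * L), Reg335Cube (scShift d L mv kk hL) U ((((L ^ kk : ℕ) : ℝ))⁻¹)
          {x : ScX d L mv kk hL | blockOf (L ^ kk) (cvM d L mv kk hL) x ∈ cubeBlocks (cvM d L mv kk hL) (coverCorner (cvM d L mv kk hL) (L ^ mv) L (L * L ^ mv + 3 * L ^ mv - 1 - coverMargin L mv + 1) k) (L * L ^ mv + 10 * L ^ mv + 2)} ξ C) →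
      ∀ (rV : ℝ), 0 ≤ rV →
        Fintype.card ι * (@basisConst ι _ (Matrix mm mm ℂ) Matrix.frobeniusNormedAddCommGroup Matrix.frobeniusNormedSpace e * (2 * Real.sqrt (Fintype.card mm)) * (Real.sqrt (Fintype.card mm) * ((C / ξ) * Real.exp (((((L ^ kk : ℕ) : ℝ))⁻¹) * (C / ξ))))) ≤ rV →
        Fintype.card ι * (Fintype.card (Fin (d + 1)) * (Fintype.card ι * (@basisConst ι _ (Matrix mm mm ℂ) Matrix.frobeniusNormedAddCommGroup Matrix.frobeniusNormedSpace e * (2 * Real.sqrt (Fintype.card mm)) * (Real.sqrt (Fintype.card mm) * ((C / ξ) * Real.exp (((((L ^ kk : ℕ) : ℝ))⁻¹) * (C / ξ))))) ^ 2 + @basisConst ι _ (Matrix mm mm ℂ) Matrix.frobeniusNormedAddCommGroup Matrix.frobeniusNormedSpace e * (2 * Real.sqrt (Fintype.card mm)) * (Real.sqrt (Fintype.card mm) * ((C / ξ ^ 2) * Real.exp (((((L ^ kk : ℕ) : ℝ))⁻¹) * (C / ξ)))))) ≤ rV →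
        rV * (1 + Fintype.card (Fin (d + 1) ⊕ Fin (d + 1))) + a₀ * (Fintype.card ι * (Fintype.card ι * ((1 + rV * ((((L ^ kk : ℕ) : ℝ))⁻¹)) ^ ((d + 1) * L ^ kk) - 1) ^ 2 + 2 * ((1 + rV * ((((L ^ kk : ℕ) : ℝ))⁻¹)) ^ ((d + 1) * L ^ kk) - 1))) ≤ R₀ →
        ((1 + rV * ((((L ^ kk : ℕ) : ℝ))⁻¹)) ^ ((d + 1) * L ^ kk) - 1) ≤ R₀ →
        HasMaj (BlockNorm.ofBlocks (unitTorusGeo L kk (cvM d L mv kk hL)) (liftBlk (fun y : Tor (cvM d L mv kk hL) => y) ι)) (BlockNorm.ofBlocks (unitTorusGeo L kk (cvM d L mv kk hL)) (liftBlk (fun y : Tor (cvM d L mv kk hL) => y) ι))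
            (Matrix.mulVecLin (cSop (cvM d L mv kk hL) (L ^ kk) (cvT e (fun μ x => (U μ x : Matrix mm mm ℂ))) (aK a₀ (L : ℝ) kk * (((L ^ kk : ℕ) : ℝ)) ^ (d + 1)))⁻¹)
          (fun y y' => B * (((L ^ kk : ℕ) : ℝ)) ^ (d + 1) * Real.exp (-(δ * (unitTorusGeo L kk (cvM d L mv kk hL)).dist y y')))) ∧
      (∀ (mv kk r : ℕ), 1 ≤ kk → w₀ ≤ ((L ^ mv : ℕ) : ℝ) →
      ∀ {mm : Type} [Fintype mm] [DecidableEq mm] [Nonempty mm] (e : Matrix mm mm ℂ ≃L[ℝ] (ι → ℝ)), (∀ A B : Matrix mm mm ℂ, traceForm A B = e A ⬝ᵥ e B) →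
      ∀ (U : Fin (d + 1) → ScX' d L mv kk r hL → (Matrix mm mm ℂ)ˣ), (∀ μ x, (U μ x : Matrix mm mm ℂ) ∈ Matrix.unitaryGroup mm ℂ) →
      ∀ (ξ C : ℝ), 0 < ξ → 0 < C →
        (∀ k : Fin (d + 1) → ZMod (2 * L), Reg335Cube (scShift' d L mv kk r hL) U ((((L ^ r * L ^ kk : ℕ) : ℝ))⁻¹)
          {x : ScX' d L mv kk r hL | blockOf (L ^ r * L ^ kk) (cvM d L mv kk hL) x ∈ cubeBlocks (cvM d L mv kk hL) (coverCorner (cvM d L mv kk hL) (L ^ mv) L (L * L ^ mv + 3 * L ^ mv - 1 - coverMargin L mv + 1) k) (L * L ^ mv + 10 * L ^ mv + 2)} ξ C) →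
      ∀ (rV : ℝ), 0 ≤ rV →
        Fintype.card ι * (@basisConst ι _ (Matrix mm mm ℂ) Matrix.frobeniusNormedAddCommGroup Matrix.frobeniusNormedSpace e * (2 * Real.sqrt (Fintype.card mm)) * (Real.sqrt (Fintype.card mm) * ((C / ξ) * Real.exp (((((L ^ r * L ^ kk : ℕ) : ℝ))⁻¹) * (C / ξ))))) ≤ rV →
        Fintype.card ι * (Fintype.card (Fin (d + 1)) * (Fintype.card ι * (@basisConst ι _ (Matrix mm mm ℂ) Matrix.frobeniusNormedAddCommGroup Matrix.frobeniusNormedSpace e * (2 * Real.sqrt (Fintype.card mm)) * (Real.sqrt (Fintype.card mm) * ((C / ξ) * Real.exp (((((L ^ r * L ^ kk : ℕ) : ℝ))⁻¹) * (C / ξ))))) ^ 2 + @basisConst ι _ (Matrix mm mm ℂ) Matrix.frobeniusNormedAddCommGroup Matrix.frobeniusNormedSpace e * (2 * Real.sqrt (Fintype.card mm)) * (Real.sqrt (Fintype.card mm) * ((C / ξ ^ 2) * Real.exp (((((L ^ r * L ^ kk : ℕ) : ℝ))⁻¹) * (C / ξ)))))) ≤ rV →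
        rV * (1 + Fintype.card (Fin (d + 1) ⊕ Fin (d + 1))) + a₀ * (Fintype.card ι * (Fintype.card ι * ((1 + rV * ((((L ^ r * L ^ kk : ℕ) : ℝ))⁻¹)) ^ ((d + 1) * (L ^ r * L ^ kk)) - 1) ^ 2 + 2 * ((1 + rV * ((((L ^ r * L ^ kk : ℕ) : ℝ))⁻¹)) ^ ((d + 1) * (L ^ r * L ^ kk)) - 1))) ≤ R₀ →
        ((1 + rV * ((((L ^ r * L ^ kk : ℕ) : ℝ))⁻¹)) ^ ((d + 1) * (L ^ r * L ^ kk)) - 1) ≤ R₀ →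
        HasMaj (BlockNorm.ofBlocks (unitTorusGeo L kk (cvM d L mv kk hL)) (liftBlk (fun y : Tor (cvM d L mv kk hL) => y) ι)) (BlockNorm.ofBlocks (unitTorusGeo L kk (cvM d L mv kk hL)) (liftBlk (fun y : Tor (cvM d L mv kk hL) => y) ι))
            (Matrix.mulVecLin (cSop (cvM d L mv kk hL) (L ^ r * L ^ kk) (cvT e (fun μ x => (U μ x : Matrix mm mm ℂ))) (aK a₀ (L : ℝ) (r + kk) * (((L ^ r * L ^ kk : ℕ) : ℝ)) ^ (d + 1)))⁻¹)
          (fun y y' => B * (((L ^ r * L ^ kk : ℕ) : ℝ)) ^ (d + 1) * Real.exp (-(δ * (unitTorusGeo L kk (cvM d L mv kk hL)).dist y y')))) := by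
  obtain ⟨δ, w₀, R₀, B, hδ, hR₀, hB, H⟩ := hasMaj_cSop_inv_of_reg335Box10 (d := d) hL hL11 ha₀ ι
  refine ⟨δ, w₀, R₀, B, hδ, hR₀, hB, H, fun mv kk r hk hw₀ => ?_⟩
  intro mm _ _ _ e he U hU ξ C hξ hC h335 rV hrV hrA hrC hRle hRle2
  delta scShift at H
  delta ScX at H
  have H1 := @H mv (r + kk) (hk.trans (Nat.le_add_left kk r)) hw₀ mm _ _ _ e he
  clear H
  generalize_proofs p0 p1 p2 p3 at H1
  revert p2 H1
  rw [show L ^ (r + kk) = L ^ r * L ^ kk from pow_add L r kk]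
  intro p2 H1
  exact H1 U hU ξ C hξ hC h335 rV hrV hrA hrC hRle hRle2

end Sop

/-! ## §2 `I − R(U)` and `R(U)` per cube, on both grids -/

section Proj

/-- ★★★ **n15-c∕299g `I − R(U)` ON BOTH GRIDS OF THE PAIRING, ONE CONSTANT BLOCK**. [cite: Balaban1985BackgroundPropagators, (3.25)–(3.26) pp.394–395 (shape); King1986, p.664 (pairing)] -/
theorem hasMaj_cPi_of_reg335BigBox_twoGrid (hL : Odd L ∧ 1 < L) (hL11 : 11 ≤ L) {a₀ : ℝ} (ha₀ : 0 < a₀) (ι : Type) [Fintype ι] [DecidableEq ι] :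
    ∃ δ w₀ R₀ B : ℝ, 0 < δ ∧ 0 < R₀ ∧ 0 < B ∧
      (∀ (mv kk : ℕ), 1 ≤ kk → w₀ ≤ ((L ^ mv : ℕ) : ℝ) →
      ∀ {mm : Type} [Fintype mm] [DecidableEq mm] [Nonempty mm] (e : Matrix mm mm ℂ ≃L[ℝ] (ι → ℝ)), (∀ A B : Matrix mm mm ℂ, traceForm A B = e A ⬝ᵥ e B) →
      ∀ (U : Fin (d + 1) → ScX d L mv kk hL → (Matrix mm mm ℂ)ˣ), (∀ μ x, (U μ x : Matrix mm mm ℂ) ∈ Matrix.unitaryGroup mm ℂ) →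
      ∀ (ξ C : ℝ), 0 < ξ → 0 < C →
        (∀ k : Fin (d + 1) → ZMod (2 * L), ∃ (u : ScX d L mv kk hL → (Matrix mm mm ℂ)ˣ) (A : Fin (d + 1) → ScX d L mv kk hL → Matrix mm mm ℂ),
          (∀ x, (u x : Matrix mm mm ℂ) ∈ Matrix.unitaryGroup mm ℂ) ∧
          (∀ μ, ∀ z ∈ {x : ScX d L mv kk hL | blockOf (L ^ kk) (cvM d L mv kk hL) x ∈ cubeBlocks (cvM d L mv kk hL) (coverCorner (cvM d L mv kk hL) (L ^ mv) L (L * L ^ mv + 3 * L ^ mv - 1 - coverMargin L mv) k) (L * L ^ mv + 10 * L ^ mv)},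
              gaugeTr (scShift d L mv kk hL) u U μ z = fluct ((((L ^ kk : ℕ) : ℝ))⁻¹) A μ z) ∧
          (∀ μ, ∀ z ∈ {x : ScX d L mv kk hL | blockOf (L ^ kk) (cvM d L mv kk hL) x ∈ cubeBlocks (cvM d L mv kk hL) (coverCorner (cvM d L mv kk hL) (L ^ mv) L (L * L ^ mv + 3 * L ^ mv - 1 - coverMargin L mv) k) (L * L ^ mv + 10 * L ^ mv)},
              ‖A μ z‖ < C * ξ⁻¹) ∧
          (∀ μ ν, ∀ z ∈ {x : ScX d L mv kk hL | blockOf (L ^ kk) (cvM d L mv kk hL) x ∈ cubeBlocks (cvM d L mv kk hL) (coverCorner (cvM d L mv kk hL) (L ^ mv) L (L * L ^ mv + 3 * L ^ mv - 1 - coverMargin L mv) k) (L * L ^ mv + 10 * L ^ mv)},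
              ‖((↑((((L ^ kk : ℕ) : ℝ))⁻¹) : ℂ)⁻¹) • covD (scShift d L mv kk hL) (fun _ _ => (1 : (Matrix mm mm ℂ)ˣ)) μ (A ν) z‖ < C * (ξ ^ 2)⁻¹)) →
      ∀ (rV : ℝ), 0 ≤ rV →
        Fintype.card ι * (@basisConst ι _ (Matrix mm mm ℂ) Matrix.frobeniusNormedAddCommGroup Matrix.frobeniusNormedSpace e * (2 * Real.sqrt (Fintype.card mm)) * (Real.sqrt (Fintype.card mm) * ((C / ξ) * Real.exp (((((L ^ kk : ℕ) : ℝ))⁻¹) * (C / ξ))))) ≤ rV →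
        Fintype.card ι * (Fintype.card (Fin (d + 1)) * (Fintype.card ι * (@basisConst ι _ (Matrix mm mm ℂ) Matrix.frobeniusNormedAddCommGroup Matrix.frobeniusNormedSpace e * (2 * Real.sqrt (Fintype.card mm)) * (Real.sqrt (Fintype.card mm) * ((C / ξ) * Real.exp (((((L ^ kk : ℕ) : ℝ))⁻¹) * (C / ξ))))) ^ 2 + @basisConst ι _ (Matrix mm mm ℂ) Matrix.frobeniusNormedAddCommGroup Matrix.frobeniusNormedSpace e * (2 * Real.sqrt (Fintype.card mm)) * (Real.sqrt (Fintype.card mm) * ((C / ξ ^ 2) * Real.exp (((((L ^ kk : ℕ) : ℝ))⁻¹) * (C / ξ)))))) ≤ rV →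
        rV * (1 + Fintype.card (Fin (d + 1) ⊕ Fin (d + 1))) + a₀ * (Fintype.card ι * (Fintype.card ι * ((1 + rV * ((((L ^ kk : ℕ) : ℝ))⁻¹)) ^ ((d + 1) * L ^ kk) - 1) ^ 2 + 2 * ((1 + rV * ((((L ^ kk : ℕ) : ℝ))⁻¹)) ^ ((d + 1) * L ^ kk) - 1))) ≤ R₀ →
        ((1 + rV * ((((L ^ kk : ℕ) : ℝ))⁻¹)) ^ ((d + 1) * L ^ kk) - 1) ≤ R₀ →
        HasMaj (ScNorm d L mv kk hL ι) (ScNorm d L mv kk hL ι)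
            (Matrix.mulVecLin (cPi (cvM d L mv kk hL) (L ^ kk) (cvT e (fun μ x => (U μ x : Matrix mm mm ℂ))) (aK a₀ (L : ℝ) kk * (((L ^ kk : ℕ) : ℝ)) ^ (d + 1))))
          (fun y y' => B * Real.exp (-(δ * (unitTorusGeo L kk (cvM d L mv kk hL)).dist y y')))) ∧
      (∀ (mv kk r : ℕ), 1 ≤ kk → w₀ ≤ ((L ^ mv : ℕ) : ℝ) →
      ∀ {mm : Type} [Fintype mm] [DecidableEq mm] [Nonempty mm] (e : Matrix mm mm ℂ ≃L[ℝ] (ι → ℝ)), (∀ A B : Matrix mm mm ℂ, traceForm A B = e A ⬝ᵥ e B) →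
      ∀ (U : Fin (d + 1) → ScX' d L mv kk r hL → (Matrix mm mm ℂ)ˣ), (∀ μ x, (U μ x : Matrix mm mm ℂ) ∈ Matrix.unitaryGroup mm ℂ) →
      ∀ (ξ C : ℝ), 0 < ξ → 0 < C →
        (∀ k : Fin (d + 1) → ZMod (2 * L), ∃ (u : ScX' d L mv kk r hL → (Matrix mm mm ℂ)ˣ) (A : Fin (d + 1) → ScX' d L mv kk r hL → Matrix mm mm ℂ),
          (∀ x, (u x : Matrix mm mm ℂ) ∈ Matrix.unitaryGroup mm ℂ) ∧
          (∀ μ, ∀ z ∈ {x : ScX' d L mv kk r hL | blockOf (L ^ r * L ^ kk) (cvM d L mv kk hL) x ∈ cubeBlocks (cvM d L mv kk hL) (coverCorner (cvM d L mv kk hL) (L ^ mv) L (L * L ^ mv + 3 * L ^ mv - 1 - coverMargin L mv) k) (L * L ^ mv + 10 * L ^ mv)},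
              gaugeTr (scShift' d L mv kk r hL) u U μ z = fluct ((((L ^ r * L ^ kk : ℕ) : ℝ))⁻¹) A μ z) ∧
          (∀ μ, ∀ z ∈ {x : ScX' d L mv kk r hL | blockOf (L ^ r * L ^ kk) (cvM d L mv kk hL) x ∈ cubeBlocks (cvM d L mv kk hL) (coverCorner (cvM d L mv kk hL) (L ^ mv) L (L * L ^ mv + 3 * L ^ mv - 1 - coverMargin L mv) k) (L * L ^ mv + 10 * L ^ mv)},
              ‖A μ z‖ < C * ξ⁻¹) ∧
          (∀ μ ν, ∀ z ∈ {x : ScX' d L mv kk r hL | blockOf (L ^ r * L ^ kk) (cvM d L mv kk hL) x ∈ cubeBlocks (cvM d L mv kk hL) (coverCorner (cvM d L mv kk hL) (L ^ mv) L (L * L ^ mv + 3 * L ^ mv - 1 - coverMargin L mv) k) (L * L ^ mv + 10 * L ^ mv)},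
              ‖((↑((((L ^ r * L ^ kk : ℕ) : ℝ))⁻¹) : ℂ)⁻¹) • covD (scShift' d L mv kk r hL) (fun _ _ => (1 : (Matrix mm mm ℂ)ˣ)) μ (A ν) z‖ < C * (ξ ^ 2)⁻¹)) →
      ∀ (rV : ℝ), 0 ≤ rV →
        Fintype.card ι * (@basisConst ι _ (Matrix mm mm ℂ) Matrix.frobeniusNormedAddCommGroup Matrix.frobeniusNormedSpace e * (2 * Real.sqrt (Fintype.card mm)) * (Real.sqrt (Fintype.card mm) * ((C / ξ) * Real.exp (((((L ^ r * L ^ kk : ℕ) : ℝ))⁻¹) * (C / ξ))))) ≤ rV →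
        Fintype.card ι * (Fintype.card (Fin (d + 1)) * (Fintype.card ι * (@basisConst ι _ (Matrix mm mm ℂ) Matrix.frobeniusNormedAddCommGroup Matrix.frobeniusNormedSpace e * (2 * Real.sqrt (Fintype.card mm)) * (Real.sqrt (Fintype.card mm) * ((C / ξ) * Real.exp (((((L ^ r * L ^ kk : ℕ) : ℝ))⁻¹) * (C / ξ))))) ^ 2 + @basisConst ι _ (Matrix mm mm ℂ) Matrix.frobeniusNormedAddCommGroup Matrix.frobeniusNormedSpace e * (2 * Real.sqrt (Fintype.card mm)) * (Real.sqrt (Fintype.card mm) * ((C / ξ ^ 2) * Real.exp (((((L ^ r * L ^ kk : ℕ) : ℝ))⁻¹) * (C / ξ)))))) ≤ rV →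
        rV * (1 + Fintype.card (Fin (d + 1) ⊕ Fin (d + 1))) + a₀ * (Fintype.card ι * (Fintype.card ι * ((1 + rV * ((((L ^ r * L ^ kk : ℕ) : ℝ))⁻¹)) ^ ((d + 1) * (L ^ r * L ^ kk)) - 1) ^ 2 + 2 * ((1 + rV * ((((L ^ r * L ^ kk : ℕ) : ℝ))⁻¹)) ^ ((d + 1) * (L ^ r * L ^ kk)) - 1))) ≤ R₀ →
        ((1 + rV * ((((L ^ r * L ^ kk : ℕ) : ℝ))⁻¹)) ^ ((d + 1) * (L ^ r * L ^ kk)) - 1) ≤ R₀ →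
        HasMaj (ScNorm' d L mv kk r hL ι) (ScNorm' d L mv kk r hL ι)
            (Matrix.mulVecLin (cPi (cvM d L mv kk hL) (L ^ r * L ^ kk) (cvT e (fun μ x => (U μ x : Matrix mm mm ℂ))) (aK a₀ (L : ℝ) (r + kk) * (((L ^ r * L ^ kk : ℕ) : ℝ)) ^ (d + 1))))
          (fun y y' => B * Real.exp (-(δ * (unitTorusGeo L kk (cvM d L mv kk hL)).dist y y')))) := by
  obtain ⟨δ, w₀, R₀, B, hδ, hR₀, hB, H⟩ := hasMaj_cPi_of_reg335BigBox (d := d) hL hL11 ha₀ ι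
  refine ⟨δ, w₀, R₀, B, hδ, hR₀, hB, H, fun mv kk r hk hw₀ => ?_⟩
  intro mm _ _ _ e he U hU ξ C hξ hC h335 rV hrV hrA hrC hRle hRle2
  delta ScNorm scShift at H
  delta scBlk at H
  delta ScX at H
  have H1 := @H mv (r + kk) (hk.trans (Nat.le_add_left kk r)) hw₀ mm _ _ _ e he
  clear H
  generalize_proofs p0 p1 p2 p3 p4 at H1
  revert p1 p4 H1
  rw [show L ^ (r + kk) = L ^ r * L ^ kk from pow_add L r kk]
  intro p1 p4 H1
  exact H1 U hU ξ C hξ hC h335 rV hrV hrA hrC hRle hRle2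

/-- ★★★ **n15-c∕299g `R(U)` ON BOTH GRIDS OF THE PAIRING, ONE CONSTANT BLOCK**. [cite: Balaban1985BackgroundPropagators, (3.25)–(3.26) pp.394–395 (shape); King1986, p.664 (pairing)] -/
theorem hasMaj_cR_of_reg335BigBox_twoGrid (hL : Odd L ∧ 1 < L) (hL11 : 11 ≤ L) {a₀ : ℝ} (ha₀ : 0 < a₀) (ι : Type) [Fintype ι] [DecidableEq ι] :
    ∃ δ w₀ R₀ B : ℝ, 0 < δ ∧ 0 < R₀ ∧ 0 < B ∧
      (∀ (mv kk : ℕ), 1 ≤ kk → w₀ ≤ ((L ^ mv : ℕ) : ℝ) →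
      ∀ {mm : Type} [Fintype mm] [DecidableEq mm] [Nonempty mm] (e : Matrix mm mm ℂ ≃L[ℝ] (ι → ℝ)), (∀ A B : Matrix mm mm ℂ, traceForm A B = e A ⬝ᵥ e B) →
      ∀ (U : Fin (d + 1) → ScX d L mv kk hL → (Matrix mm mm ℂ)ˣ), (∀ μ x, (U μ x : Matrix mm mm ℂ) ∈ Matrix.unitaryGroup mm ℂ) →
      ∀ (ξ C : ℝ), 0 < ξ → 0 < C →
        (∀ k : Fin (d + 1) → ZMod (2 * L), ∃ (u : ScX d L mv kk hL → (Matrix mm mm ℂ)ˣ) (A : Fin (d + 1) → ScX d L mv kk hL → Matrix mm mm ℂ),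
          (∀ x, (u x : Matrix mm mm ℂ) ∈ Matrix.unitaryGroup mm ℂ) ∧
          (∀ μ, ∀ z ∈ {x : ScX d L mv kk hL | blockOf (L ^ kk) (cvM d L mv kk hL) x ∈ cubeBlocks (cvM d L mv kk hL) (coverCorner (cvM d L mv kk hL) (L ^ mv) L (L * L ^ mv + 3 * L ^ mv - 1 - coverMargin L mv) k) (L * L ^ mv + 10 * L ^ mv)},
              gaugeTr (scShift d L mv kk hL) u U μ z = fluct ((((L ^ kk : ℕ) : ℝ))⁻¹) A μ z) ∧
          (∀ μ, ∀ z ∈ {x : ScX d L mv kk hL | blockOf (L ^ kk) (cvM d L mv kk hL) x ∈ cubeBlocks (cvM d L mv kk hL) (coverCorner (cvM d L mv kk hL) (L ^ mv) L (L * L ^ mv + 3 * L ^ mv - 1 - coverMargin L mv) k) (L * L ^ mv + 10 * L ^ mv)},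
              ‖A μ z‖ < C * ξ⁻¹) ∧
          (∀ μ ν, ∀ z ∈ {x : ScX d L mv kk hL | blockOf (L ^ kk) (cvM d L mv kk hL) x ∈ cubeBlocks (cvM d L mv kk hL) (coverCorner (cvM d L mv kk hL) (L ^ mv) L (L * L ^ mv + 3 * L ^ mv - 1 - coverMargin L mv) k) (L * L ^ mv + 10 * L ^ mv)},
              ‖((↑((((L ^ kk : ℕ) : ℝ))⁻¹) : ℂ)⁻¹) • covD (scShift d L mv kk hL) (fun _ _ => (1 : (Matrix mm mm ℂ)ˣ)) μ (A ν) z‖ < C * (ξ ^ 2)⁻¹)) →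
      ∀ (rV : ℝ), 0 ≤ rV →
        Fintype.card ι * (@basisConst ι _ (Matrix mm mm ℂ) Matrix.frobeniusNormedAddCommGroup Matrix.frobeniusNormedSpace e * (2 * Real.sqrt (Fintype.card mm)) * (Real.sqrt (Fintype.card mm) * ((C / ξ) * Real.exp (((((L ^ kk : ℕ) : ℝ))⁻¹) * (C / ξ))))) ≤ rV →
        Fintype.card ι * (Fintype.card (Fin (d + 1)) * (Fintype.card ι * (@basisConst ι _ (Matrix mm mm ℂ) Matrix.frobeniusNormedAddCommGroup Matrix.frobeniusNormedSpace e * (2 * Real.sqrt (Fintype.card mm)) * (Real.sqrt (Fintype.card mm) * ((C / ξ) * Real.exp (((((L ^ kk : ℕ) : ℝ))⁻¹) * (C / ξ))))) ^ 2 + @basisConst ι _ (Matrix mm mm ℂ) Matrix.frobeniusNormedAddCommGroup Matrix.frobeniusNormedSpace e * (2 * Real.sqrt (Fintype.card mm)) * (Real.sqrt (Fintype.card mm) * ((C / ξ ^ 2) * Real.exp (((((L ^ kk : ℕ) : ℝ))⁻¹) * (C / ξ)))))) ≤ rV →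
        rV * (1 + Fintype.card (Fin (d + 1) ⊕ Fin (d + 1))) + a₀ * (Fintype.card ι * (Fintype.card ι * ((1 + rV * ((((L ^ kk : ℕ) : ℝ))⁻¹)) ^ ((d + 1) * L ^ kk) - 1) ^ 2 + 2 * ((1 + rV * ((((L ^ kk : ℕ) : ℝ))⁻¹)) ^ ((d + 1) * L ^ kk) - 1))) ≤ R₀ →
        ((1 + rV * ((((L ^ kk : ℕ) : ℝ))⁻¹)) ^ ((d + 1) * L ^ kk) - 1) ≤ R₀ →
        HasMaj (ScNorm d L mv kk hL ι) (ScNorm d L mv kk hL ι)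
            (Matrix.mulVecLin (cR (cvM d L mv kk hL) (L ^ kk) (cvT e (fun μ x => (U μ x : Matrix mm mm ℂ))) (aK a₀ (L : ℝ) kk * (((L ^ kk : ℕ) : ℝ)) ^ (d + 1))))
          (fun y y' => (1 + B) * Real.exp (-(δ * (unitTorusGeo L kk (cvM d L mv kk hL)).dist y y')))) ∧
      (∀ (mv kk r : ℕ), 1 ≤ kk → w₀ ≤ ((L ^ mv : ℕ) : ℝ) →
      ∀ {mm : Type} [Fintype mm] [DecidableEq mm] [Nonempty mm] (e : Matrix mm mm ℂ ≃L[ℝ] (ι → ℝ)), (∀ A B : Matrix mm mm ℂ, traceForm A B = e A ⬝ᵥ e B) →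
      ∀ (U : Fin (d + 1) → ScX' d L mv kk r hL → (Matrix mm mm ℂ)ˣ), (∀ μ x, (U μ x : Matrix mm mm ℂ) ∈ Matrix.unitaryGroup mm ℂ) →
      ∀ (ξ C : ℝ), 0 < ξ → 0 < C →
        (∀ k : Fin (d + 1) → ZMod (2 * L), ∃ (u : ScX' d L mv kk r hL → (Matrix mm mm ℂ)ˣ) (A : Fin (d + 1) → ScX' d L mv kk r hL → Matrix mm mm ℂ),
          (∀ x, (u x : Matrix mm mm ℂ) ∈ Matrix.unitaryGroup mm ℂ) ∧
          (∀ μ, ∀ z ∈ {x : ScX' d L mv kk r hL | blockOf (L ^ r * L ^ kk) (cvM d L mv kk hL) x ∈ cubeBlocks (cvM d L mv kk hL) (coverCorner (cvM d L mv kk hL) (L ^ mv) L (L * L ^ mv + 3 * L ^ mv - 1 - coverMargin L mv) k) (L * L ^ mv + 10 * L ^ mv)},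
              gaugeTr (scShift' d L mv kk r hL) u U μ z = fluct ((((L ^ r * L ^ kk : ℕ) : ℝ))⁻¹) A μ z) ∧
          (∀ μ, ∀ z ∈ {x : ScX' d L mv kk r hL | blockOf (L ^ r * L ^ kk) (cvM d L mv kk hL) x ∈ cubeBlocks (cvM d L mv kk hL) (coverCorner (cvM d L mv kk hL) (L ^ mv) L (L * L ^ mv + 3 * L ^ mv - 1 - coverMargin L mv) k) (L * L ^ mv + 10 * L ^ mv)},
              ‖A μ z‖ < C * ξ⁻¹) ∧
          (∀ μ ν, ∀ z ∈ {x : ScX' d L mv kk r hL | blockOf (L ^ r * L ^ kk) (cvM d L mv kk hL) x ∈ cubeBlocks (cvM d L mv kk hL) (coverCorner (cvM d L mv kk hL) (L ^ mv) L (L * L ^ mv + 3 * L ^ mv - 1 - coverMargin L mv) k) (L * L ^ mv + 10 * L ^ mv)},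
              ‖((↑((((L ^ r * L ^ kk : ℕ) : ℝ))⁻¹) : ℂ)⁻¹) • covD (scShift' d L mv kk r hL) (fun _ _ => (1 : (Matrix mm mm ℂ)ˣ)) μ (A ν) z‖ < C * (ξ ^ 2)⁻¹)) →
      ∀ (rV : ℝ), 0 ≤ rV →
        Fintype.card ι * (@basisConst ι _ (Matrix mm mm ℂ) Matrix.frobeniusNormedAddCommGroup Matrix.frobeniusNormedSpace e * (2 * Real.sqrt (Fintype.card mm)) * (Real.sqrt (Fintype.card mm) * ((C / ξ) * Real.exp (((((L ^ r * L ^ kk : ℕ) : ℝ))⁻¹) * (C / ξ))))) ≤ rV →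
        Fintype.card ι * (Fintype.card (Fin (d + 1)) * (Fintype.card ι * (@basisConst ι _ (Matrix mm mm ℂ) Matrix.frobeniusNormedAddCommGroup Matrix.frobeniusNormedSpace e * (2 * Real.sqrt (Fintype.card mm)) * (Real.sqrt (Fintype.card mm) * ((C / ξ) * Real.exp (((((L ^ r * L ^ kk : ℕ) : ℝ))⁻¹) * (C / ξ))))) ^ 2 + @basisConst ι _ (Matrix mm mm ℂ) Matrix.frobeniusNormedAddCommGroup Matrix.frobeniusNormedSpace e * (2 * Real.sqrt (Fintype.card mm)) * (Real.sqrt (Fintype.card mm) * ((C / ξ ^ 2) * Real.exp (((((L ^ r * L ^ kk : ℕ) : ℝ))⁻¹) * (C / ξ)))))) ≤ rV →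
        rV * (1 + Fintype.card (Fin (d + 1) ⊕ Fin (d + 1))) + a₀ * (Fintype.card ι * (Fintype.card ι * ((1 + rV * ((((L ^ r * L ^ kk : ℕ) : ℝ))⁻¹)) ^ ((d + 1) * (L ^ r * L ^ kk)) - 1) ^ 2 + 2 * ((1 + rV * ((((L ^ r * L ^ kk : ℕ) : ℝ))⁻¹)) ^ ((d + 1) * (L ^ r * L ^ kk)) - 1))) ≤ R₀ →
        ((1 + rV * ((((L ^ r * L ^ kk : ℕ) : ℝ))⁻¹)) ^ ((d + 1) * (L ^ r * L ^ kk)) - 1) ≤ R₀ →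
        HasMaj (ScNorm' d L mv kk r hL ι) (ScNorm' d L mv kk r hL ι)
            (Matrix.mulVecLin (cR (cvM d L mv kk hL) (L ^ r * L ^ kk) (cvT e (fun μ x => (U μ x : Matrix mm mm ℂ))) (aK a₀ (L : ℝ) (r + kk) * (((L ^ r * L ^ kk : ℕ) : ℝ)) ^ (d + 1))))
          (fun y y' => (1 + B) * Real.exp (-(δ * (unitTorusGeo L kk (cvM d L mv kk hL)).dist y y')))) := by
  obtain ⟨δ, w₀, R₀, B, hδ, hR₀, hB, H⟩ := hasMaj_cR_of_reg335BigBox (d := d) hL hL11 ha₀ ι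
  refine ⟨δ, w₀, R₀, B, hδ, hR₀, hB, H, fun mv kk r hk hw₀ => ?_⟩
  intro mm _ _ _ e he U hU ξ C hξ hC h335 rV hrV hrA hrC hRle hRle2
  delta ScNorm scShift at H
  delta scBlk at H
  delta ScX at H
  have H1 := @H mv (r + kk) (hk.trans (Nat.le_add_left kk r)) hw₀ mm _ _ _ e he
  clear H
  generalize_proofs p0 p1 p2 p3 p4 at H1
  revert p1 p4 H1
  rw [show L ^ (r + kk) = L ^ r * L ^ kk from pow_add L r kk]
  intro p1 p4 H1
  exact H1 U hU ξ C hξ hC h335 rV hrV hrA hrC hRle hRle2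

end Proj

/-! ## §3 `D_U(I − R(U))D*_U` per cube, on both grids -/

section Landau

/-- ★★★ **n15-c∕299h `D_U(I − R(U))D*_U` ON BOTH GRIDS OF THE PAIRING, ONE CONSTANT BLOCK** (bond block norms with the unit-block map `b ↦ blockOf n (cvM) b.1`; n15-c∕327
`cvBlk_comp_kingPrV` converts the fine one to `cvBlk ∘ kingPrV`). [cite: Balaban1985BackgroundPropagators, (3.25)–(3.26) pp.394–395, Thm 3.3 p.398 (shape); King1986, p.664 (pairing)] -/
theorem hasMaj_landauCov_of_reg335BigBox_twoGrid (hL : Odd L ∧ 1 < L) (hL11 : 11 ≤ L) {a₀ : ℝ} (ha₀ : 0 < a₀) (ι : Type) [Fintype ι] [DecidableEq ι] :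
    ∃ δ w₀ R₀ B : ℝ, 0 < δ ∧ 0 < R₀ ∧ 0 < B ∧
      (∀ (mv kk : ℕ), 1 ≤ kk → w₀ ≤ ((L ^ mv : ℕ) : ℝ) →
      ∀ {mm : Type} [Fintype mm] [DecidableEq mm] [Nonempty mm] (e : Matrix mm mm ℂ ≃L[ℝ] (ι → ℝ)), (∀ A B : Matrix mm mm ℂ, traceForm A B = e A ⬝ᵥ e B) →
      ∀ (U : Fin (d + 1) → ScX d L mv kk hL → (Matrix mm mm ℂ)ˣ), (∀ μ x, (U μ x : Matrix mm mm ℂ) ∈ Matrix.unitaryGroup mm ℂ) →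
      ∀ (ξ C : ℝ), 0 < ξ → 0 < C →
        (∀ k : Fin (d + 1) → ZMod (2 * L), ∃ (u : ScX d L mv kk hL → (Matrix mm mm ℂ)ˣ) (A : Fin (d + 1) → ScX d L mv kk hL → Matrix mm mm ℂ),
          (∀ x, (u x : Matrix mm mm ℂ) ∈ Matrix.unitaryGroup mm ℂ) ∧
          (∀ μ, ∀ z ∈ {x : ScX d L mv kk hL | blockOf (L ^ kk) (cvM d L mv kk hL) x ∈ cubeBlocks (cvM d L mv kk hL) (coverCorner (cvM d L mv kk hL) (L ^ mv) L (L * L ^ mv + 3 * L ^ mv - 1 - coverMargin L mv) k) (L * L ^ mv + 10 * L ^ mv)},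
              gaugeTr (scShift d L mv kk hL) u U μ z = fluct ((((L ^ kk : ℕ) : ℝ))⁻¹) A μ z) ∧
          (∀ μ, ∀ z ∈ {x : ScX d L mv kk hL | blockOf (L ^ kk) (cvM d L mv kk hL) x ∈ cubeBlocks (cvM d L mv kk hL) (coverCorner (cvM d L mv kk hL) (L ^ mv) L (L * L ^ mv + 3 * L ^ mv - 1 - coverMargin L mv) k) (L * L ^ mv + 10 * L ^ mv)},
              ‖A μ z‖ < C * ξ⁻¹) ∧
          (∀ μ ν, ∀ z ∈ {x : ScX d L mv kk hL | blockOf (L ^ kk) (cvM d L mv kk hL) x ∈ cubeBlocks (cvM d L mv kk hL) (coverCorner (cvM d L mv kk hL) (L ^ mv) L (L * L ^ mv + 3 * L ^ mv - 1 - coverMargin L mv) k) (L * L ^ mv + 10 * L ^ mv)},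
              ‖((↑((((L ^ kk : ℕ) : ℝ))⁻¹) : ℂ)⁻¹) • B9Eq39Adjoint.covD (scShift d L mv kk hL) (fun _ _ => (1 : (Matrix mm mm ℂ)ˣ)) μ (A ν) z‖ < C * (ξ ^ 2)⁻¹)) →
      ∀ (rV : ℝ), 0 ≤ rV →
        Fintype.card ι * (@basisConst ι _ (Matrix mm mm ℂ) Matrix.frobeniusNormedAddCommGroup Matrix.frobeniusNormedSpace e * (2 * Real.sqrt (Fintype.card mm)) * (Real.sqrt (Fintype.card mm) * ((C / ξ) * Real.exp (((((L ^ kk : ℕ) : ℝ))⁻¹) * (C / ξ))))) ≤ rV →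
        Fintype.card ι * (Fintype.card (Fin (d + 1)) * (Fintype.card ι * (@basisConst ι _ (Matrix mm mm ℂ) Matrix.frobeniusNormedAddCommGroup Matrix.frobeniusNormedSpace e * (2 * Real.sqrt (Fintype.card mm)) * (Real.sqrt (Fintype.card mm) * ((C / ξ) * Real.exp (((((L ^ kk : ℕ) : ℝ))⁻¹) * (C / ξ))))) ^ 2 + @basisConst ι _ (Matrix mm mm ℂ) Matrix.frobeniusNormedAddCommGroup Matrix.frobeniusNormedSpace e * (2 * Real.sqrt (Fintype.card mm)) * (Real.sqrt (Fintype.card mm) * ((C / ξ ^ 2) * Real.exp (((((L ^ kk : ℕ) : ℝ))⁻¹) * (C / ξ)))))) ≤ rV →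
        Fintype.card ι * (@basisConst ι _ (Matrix mm mm ℂ) Matrix.frobeniusNormedAddCommGroup Matrix.frobeniusNormedSpace e * (2 * Real.sqrt (Fintype.card mm)) * (Real.sqrt (Fintype.card mm) * ((C / ξ ^ 2) * Real.exp (((((L ^ kk : ℕ) : ℝ))⁻¹) * (C / ξ))))) ≤ rV →
        rV * (1 + Fintype.card (Fin (d + 1) ⊕ Fin (d + 1))) + a₀ * (Fintype.card ι * (Fintype.card ι * ((1 + rV * ((((L ^ kk : ℕ) : ℝ))⁻¹)) ^ ((d + 1) * L ^ kk) - 1) ^ 2 + 2 * ((1 + rV * ((((L ^ kk : ℕ) : ℝ))⁻¹)) ^ ((d + 1) * L ^ kk) - 1))) ≤ R₀ →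
        ((1 + rV * ((((L ^ kk : ℕ) : ℝ))⁻¹)) ^ ((d + 1) * L ^ kk) - 1) ≤ R₀ →
        HasMaj (BlockNorm.ofBlocks (unitTorusGeo L kk (cvM d L mv kk hL)) (liftBlk (fun b : ScX d L mv kk hL × Fin (d + 1) => blockOf (L ^ kk) (cvM d L mv kk hL) b.1) ι))
            (BlockNorm.ofBlocks (unitTorusGeo L kk (cvM d L mv kk hL)) (liftBlk (fun b : ScX d L mv kk hL × Fin (d + 1) => blockOf (L ^ kk) (cvM d L mv kk hL) b.1) ι))
            (Matrix.mulVecLin (landauCov (cvM d L mv kk hL) (L ^ kk) (cvT e (fun μ x => (U μ x : Matrix mm mm ℂ))) (aK a₀ (L : ℝ) kk * (((L ^ kk : ℕ) : ℝ)) ^ (d + 1))))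
          (fun y y' => B * Real.exp (-(δ * (unitTorusGeo L kk (cvM d L mv kk hL)).dist y y')))) ∧
      (∀ (mv kk r : ℕ), 1 ≤ kk → w₀ ≤ ((L ^ mv : ℕ) : ℝ) →
      ∀ {mm : Type} [Fintype mm] [DecidableEq mm] [Nonempty mm] (e : Matrix mm mm ℂ ≃L[ℝ] (ι → ℝ)), (∀ A B : Matrix mm mm ℂ, traceForm A B = e A ⬝ᵥ e B) →
      ∀ (U : Fin (d + 1) → ScX' d L mv kk r hL → (Matrix mm mm ℂ)ˣ), (∀ μ x, (U μ x : Matrix mm mm ℂ) ∈ Matrix.unitaryGroup mm ℂ) →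
      ∀ (ξ C : ℝ), 0 < ξ → 0 < C →
        (∀ k : Fin (d + 1) → ZMod (2 * L), ∃ (u : ScX' d L mv kk r hL → (Matrix mm mm ℂ)ˣ) (A : Fin (d + 1) → ScX' d L mv kk r hL → Matrix mm mm ℂ),
          (∀ x, (u x : Matrix mm mm ℂ) ∈ Matrix.unitaryGroup mm ℂ) ∧
          (∀ μ, ∀ z ∈ {x : ScX' d L mv kk r hL | blockOf (L ^ r * L ^ kk) (cvM d L mv kk hL) x ∈ cubeBlocks (cvM d L mv kk hL) (coverCorner (cvM d L mv kk hL) (L ^ mv) L (L * L ^ mv + 3 * L ^ mv - 1 - coverMargin L mv) k) (L * L ^ mv + 10 * L ^ mv)},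
              gaugeTr (scShift' d L mv kk r hL) u U μ z = fluct ((((L ^ r * L ^ kk : ℕ) : ℝ))⁻¹) A μ z) ∧
          (∀ μ, ∀ z ∈ {x : ScX' d L mv kk r hL | blockOf (L ^ r * L ^ kk) (cvM d L mv kk hL) x ∈ cubeBlocks (cvM d L mv kk hL) (coverCorner (cvM d L mv kk hL) (L ^ mv) L (L * L ^ mv + 3 * L ^ mv - 1 - coverMargin L mv) k) (L * L ^ mv + 10 * L ^ mv)},
              ‖A μ z‖ < C * ξ⁻¹) ∧
          (∀ μ ν, ∀ z ∈ {x : ScX' d L mv kk r hL | blockOf (L ^ r * L ^ kk) (cvM d L mv kk hL) x ∈ cubeBlocks (cvM d L mv kk hL) (coverCorner (cvM d L mv kk hL) (L ^ mv) L (L * L ^ mv + 3 * L ^ mv - 1 - coverMargin L mv) k) (L * L ^ mv + 10 * L ^ mv)},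
              ‖((↑((((L ^ r * L ^ kk : ℕ) : ℝ))⁻¹) : ℂ)⁻¹) • B9Eq39Adjoint.covD (scShift' d L mv kk r hL) (fun _ _ => (1 : (Matrix mm mm ℂ)ˣ)) μ (A ν) z‖ < C * (ξ ^ 2)⁻¹)) →
      ∀ (rV : ℝ), 0 ≤ rV →
        Fintype.card ι * (@basisConst ι _ (Matrix mm mm ℂ) Matrix.frobeniusNormedAddCommGroup Matrix.frobeniusNormedSpace e * (2 * Real.sqrt (Fintype.card mm)) * (Real.sqrt (Fintype.card mm) * ((C / ξ) * Real.exp (((((L ^ r * L ^ kk : ℕ) : ℝ))⁻¹) * (C / ξ))))) ≤ rV →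
        Fintype.card ι * (Fintype.card (Fin (d + 1)) * (Fintype.card ι * (@basisConst ι _ (Matrix mm mm ℂ) Matrix.frobeniusNormedAddCommGroup Matrix.frobeniusNormedSpace e * (2 * Real.sqrt (Fintype.card mm)) * (Real.sqrt (Fintype.card mm) * ((C / ξ) * Real.exp (((((L ^ r * L ^ kk : ℕ) : ℝ))⁻¹) * (C / ξ))))) ^ 2 + @basisConst ι _ (Matrix mm mm ℂ) Matrix.frobeniusNormedAddCommGroup Matrix.frobeniusNormedSpace e * (2 * Real.sqrt (Fintype.card mm)) * (Real.sqrt (Fintype.card mm) * ((C / ξ ^ 2) * Real.exp (((((L ^ r * L ^ kk : ℕ) : ℝ))⁻¹) * (C / ξ)))))) ≤ rV →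
        Fintype.card ι * (@basisConst ι _ (Matrix mm mm ℂ) Matrix.frobeniusNormedAddCommGroup Matrix.frobeniusNormedSpace e * (2 * Real.sqrt (Fintype.card mm)) * (Real.sqrt (Fintype.card mm) * ((C / ξ ^ 2) * Real.exp (((((L ^ r * L ^ kk : ℕ) : ℝ))⁻¹) * (C / ξ))))) ≤ rV →
        rV * (1 + Fintype.card (Fin (d + 1) ⊕ Fin (d + 1))) + a₀ * (Fintype.card ι * (Fintype.card ι * ((1 + rV * ((((L ^ r * L ^ kk : ℕ) : ℝ))⁻¹)) ^ ((d + 1) * (L ^ r * L ^ kk)) - 1) ^ 2 + 2 * ((1 + rV * ((((L ^ r * L ^ kk : ℕ) : ℝ))⁻¹)) ^ ((d + 1) * (L ^ r * L ^ kk)) - 1))) ≤ R₀ →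
        ((1 + rV * ((((L ^ r * L ^ kk : ℕ) : ℝ))⁻¹)) ^ ((d + 1) * (L ^ r * L ^ kk)) - 1) ≤ R₀ →
        HasMaj (BlockNorm.ofBlocks (unitTorusGeo L kk (cvM d L mv kk hL)) (liftBlk (fun b : ScX' d L mv kk r hL × Fin (d + 1) => blockOf (L ^ r * L ^ kk) (cvM d L mv kk hL) b.1) ι))
            (BlockNorm.ofBlocks (unitTorusGeo L kk (cvM d L mv kk hL)) (liftBlk (fun b : ScX' d L mv kk r hL × Fin (d + 1) => blockOf (L ^ r * L ^ kk) (cvM d L mv kk hL) b.1) ι))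
            (Matrix.mulVecLin (landauCov (cvM d L mv kk hL) (L ^ r * L ^ kk) (cvT e (fun μ x => (U μ x : Matrix mm mm ℂ))) (aK a₀ (L : ℝ) (r + kk) * (((L ^ r * L ^ kk : ℕ) : ℝ)) ^ (d + 1))))
          (fun y y' => B * Real.exp (-(δ * (unitTorusGeo L kk (cvM d L mv kk hL)).dist y y')))) := by
  obtain ⟨δ, w₀, R₀, B, hδ, hR₀, hB, H⟩ := hasMaj_landauCov_of_reg335BigBox (d := d) hL hL11 ha₀ ι
  refine ⟨δ, w₀, R₀, B, hδ, hR₀, hB, H, fun mv kk r hk hw₀ => ?_⟩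
  intro mm _ _ _ e he U hU ξ C hξ hC h335 rV hrV hrA hrC hrB hRle hRle2
  delta scShift at H
  delta ScX at H
  have H1 := @H mv (r + kk) (hk.trans (Nat.le_add_left kk r)) hw₀ mm _ _ _ e he
  clear H
  generalize_proofs p0 p1 p2 p3 p4 at H1
  revert p1 p4 H1
  rw [show L ^ (r + kk) = L ^ r * L ^ kk from pow_add L r kk]
  intro p1 p4 H1
  exact H1 U hU ξ C hξ hC h335 rV hrV hrA hrC hrB hRle hRle2

end Landau

end Summit.QuantumFields.YangMills.BalabanUVNodes.N15.Gluing
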